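import Summits.RiemannHypothesis.RiemannHypothesis.Theorems.JensenLogBandCanaryTaylor
import HarnessLib

/-!
# E-CANARY-128 — D3, analytic half (2/2): `PieceIneq ⇒` Henrici's step rule, `AxisIneq ⇒` the axis sign

RH-FREE. The ANALYTIC half of the contract of `…CanaryDefs` (the arithmetic half, `checkPiece = true → PieceIneq`,
is eng g8's `…CanarySound`):

* **`re_div_pos_of_pieceIneq`** — `PieceIneq a b L d K N J xbar → ∀ z, ‖z − pieceCentre a b‖ ≤ L/2 →
  0 < (canaryF z / I^d).re`: the step rule on the closed disc of radius `h = L/2` about the piece centre, a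
  fortiori on the closed piece. Proof: Taylor's series of `canaryF` at `z_c` (`hasSum_canaryF_taylor`), the
  truncation bounds for the `j ≤ K` derivatives, the log-concavity majorant + Taylor tail for `j > K`
  (`…CanaryTaylor`), and `Re (w/I^d) ≥ Re (v/I^d) − ‖w − v‖`;
* **`re_div_pos_of_axisIneq`** — `AxisIneq a d N xbar → 0 < (canaryF (pieceCentre a 0) / I^d).re`, with the
  real-axis readings `canaryF_re_pos_of_axisIneq` (`d = 0`: `0 < Re canaryF (a/2)`) and
  `canaryF_re_neg_of_axisIneq` (`d = 2`: `Re canaryF (a/2) < 0`) in the shape of `CanaryAssembly`'s alternation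
  hypothesis; §10 restates the two results with explicit binders (`stepRule_of_pieceIneq`,
  `axisSign_of_axisIneq`) — verbatim the shapes the assembly file quantifies over.

Cell rh-jensen, E-CANARY D3 (director-rh g8 2026-08-27 «D3 = GO»; support item `XiDerivEdgeReal`, PLAN-ONLY line
«E-CANARY-128»). WHAT THIS IS NOT: soundness lemmas for ONE certified instance; nothing here bears on zeros of `ζ`
or on the truth of RH.
-/

-- D-0017: the doubled namespace is by design.
set_option linter.dupNamespace false
set_option autoImplicit false

noncomputable section

namespace Summit.RiemannHypothesis.RiemannHypothesis.Theorems.JensenPolynomials.LogBand.Canary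

open Literature.NumberTheory.LFunctions Complex Finset
open scoped Nat

/-! ## 8. Henrici's step rule from `PieceIneq`; the axis sign from `AxisIneq` -/

/-- `‖w / I^d‖ = ‖w‖`. -/
theorem norm_div_I_pow (w : ℂ) (d : ℕ) : ‖w / I ^ d‖ = ‖w‖ := by
  rw [norm_div, norm_pow, Complex.norm_I, one_pow, div_one]

/-- `Re (v / I^d) − ‖w − v‖ ≤ Re (w / I^d)`. -/
theorem re_div_I_pow_ge (w v : ℂ) (d : ℕ) : (v / I ^ d).re - ‖w - v‖ ≤ (w / I ^ d).re := by
  have h : (w / I ^ d).re = (v / I ^ d).re + ((w - v) / I ^ d).re := by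
    rw [← Complex.add_re, ← add_div]; congr 2; ring
  rw [h]
  have h1 := abs_re_le_norm ((w - v) / I ^ d)
  rw [norm_div_I_pow] at h1
  linarith [(abs_le.mp h1).1]

/-- **The analytic half of the contract (pieces).** `PieceIneq a b L d K N J xbar` implies Henrici's step rule
`0 < Re (canaryF z / I^d)` for every `z` in the closed disc of radius `h = L/2` about the piece centre
`z_c = (a + b·I)/2` — in particular on the whole closed piece. Ingredients: Taylor's series of the entire function
`canaryF` at `z_c` (`hasSum_canaryF_taylor`), the truncation bounds `norm_canaryD_sub_canaryS_le` for the
`j ≤ K` derivatives, the log-concavity majorant `norm_canaryD_le` + `summable_and_tsum_taylorTail_le` for `j > K`,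
and `summable_canaryA_zero_and_canaryFsum_le` for the majorant value. RH-FREE. -/
theorem re_div_pos_of_pieceIneq {a b : ℤ} {L d K N J xbar : ℕ} (hP : PieceIneq a b L d K N J xbar)
    (z : ℂ) (hz : ‖z - pieceCentre a b‖ ≤ (L : ℝ) / 2) : 0 < (canaryF z / I ^ d).re := by
  obtain ⟨hKN, hc, hq1, hq2, hineq⟩ := hP
  set c := pieceCentre a b with hcdef
  set h : ℝ := (L : ℝ) / 2 with hhdef
  set x : ℝ := (xbar : ℝ) with hxdef
  have hx : 0 ≤ x := Nat.cast_nonneg _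
  have hh : 0 ≤ h := by positivity
  -- truncation ratios for `j ≤ K`, in particular `j = 0`
  have hqj : ∀ j, j ≤ K → canaryTruncQ j N x < 1 := fun j hj => (canaryTruncQ_mono hx hj).trans_lt hq1
  have hq0 : canaryTruncQ 0 N x < 1 := hqj 0 (Nat.zero_le _)
  obtain ⟨hsA, hFsum⟩ := summable_canaryA_zero_and_canaryFsum_le (N := N) hx hq0
  set M := canaryFmaj N x + canaryTrunc 0 N x with hMdef
  set Fx := canaryFsum x with hFxdef
  have hFx0 : 0 ≤ Fx := canaryFsum_nonneg hx
  obtain ⟨hsT, hTT⟩ := summable_and_tsum_taylorTail_le (K := K) (J := J) hh hq2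
  have hTT0 : 0 ≤ canaryTaylorTail K J h := (tsum_nonneg fun i => canaryA_nonneg 0 hh _).trans hTT
  -- the majorant of the shifted Taylor series
  let bD : ℕ → ℝ := fun j => if j ≤ K then ‖canaryS j N c‖ + canaryTrunc j N x else canaryR j * Fx
  let g : ℕ → ℝ := fun i => h ^ (i + 1) / ((i + 1) ! : ℝ) * bD (i + 1)
  have hbD : ∀ j, ‖canaryD j c‖ ≤ bD j := by
    intro j
    by_cases hjK : j ≤ K
    · simp only [bD, if_pos hjK]
      have h1 := norm_canaryD_sub_canaryS_le hc (hjK.trans (by omega)) (hqj j hjK)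
      calc ‖canaryD j c‖ = ‖canaryS j N c + (canaryD j c - canaryS j N c)‖ := by rw [add_sub_cancel]
        _ ≤ ‖canaryS j N c‖ + ‖canaryD j c - canaryS j N c‖ := norm_add_le _ _
        _ ≤ ‖canaryS j N c‖ + canaryTrunc j N x := add_le_add le_rfl h1
    · simp only [bD, if_neg hjK]
      exact norm_canaryD_le hc hsA
  have hbD0 : ∀ j, 0 ≤ bD j := fun j => (norm_nonneg _).trans (hbD j)
  -- Taylor's series shifted by one term: `canaryF z − canaryF c = Σ_i (z−c)^{i+1}/(i+1)! · canaryD (i+1) c`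
  have hT1 := (hasSum_nat_add_iff' (f := fun j : ℕ => (z - c) ^ j / (j ! : ℂ) * canaryD j c) 1).mpr
    (hasSum_canaryF_taylor c z)
  simp only [Finset.sum_range_one, pow_zero, Nat.factorial_zero, Nat.cast_one, div_one, one_mul,
    canaryD_zero] at hT1
  -- termwise domination by `g`
  have hterm : ∀ i, ‖(z - c) ^ (i + 1) / ((i + 1) ! : ℂ) * canaryD (i + 1) c‖ ≤ g i := by
    intro i
    rw [norm_mul, norm_div, norm_pow, Complex.norm_natCast]
    refine mul_le_mul ?_ (hbD (i + 1)) (norm_nonneg _) (by positivity)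
    exact div_le_div_of_nonneg_right (pow_le_pow_left₀ (norm_nonneg _) hz _) (by positivity)
  -- the tail of `g` beyond `K` is `Fx ·` (Taylor tail terms)
  have hg_tail : ∀ i, g (i + K) = Fx * canaryA 0 h (i + (K + 1)) := by
    intro i
    simp only [g, bD, if_neg (show ¬ (i + K + 1 ≤ K) from by omega)]
    unfold canaryA
    rw [Nat.add_zero, show i + K + 1 = i + (K + 1) from by ring]
    ring
  have hsg : Summable g := by
    have h1 : Summable (fun i => g (i + K)) := by
      have : (fun i => g (i + K)) = fun i => Fx * canaryA 0 h (i + (K + 1)) := funext hg_tail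
      rw [this]
      exact hsT.mul_left Fx
    exact (summable_nat_add_iff K).mp h1
  -- the value of `Σ g`: finite part (`j = 1 … K`) + `Fx ·` Taylor tail
  have hg_sum : ∑' i, g i ≤
      (∑ j ∈ Finset.Icc 1 K, (‖canaryS j N c‖ + canaryTrunc j N x) * h ^ j / (j ! : ℝ)) +
        M * canaryTaylorTail K J h := by
    rw [← hsg.sum_add_tsum_nat_add K]
    refine add_le_add (le_of_eq ?_) ?_
    · -- reindex `i + 1 = j`
      let f : ℕ → ℝ := fun j => h ^ j / (j ! : ℝ) * bD j
      have hgf : ∀ i, g i = f (i + 1) := by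
        intro i; simp only [g, f]
      rw [Finset.sum_congr rfl fun i _ => hgf i, Finset.range_eq_Ico, Finset.sum_Ico_add' f 0 K 1,
        Nat.zero_add, Finset.Ico_add_one_right_eq_Icc]
      refine Finset.sum_congr rfl fun j hj => ?_
      rw [Finset.mem_Icc] at hj
      simp only [f, bD, if_pos hj.2]
      ring
    · calc ∑' i, g (i + K) = ∑' i, Fx * canaryA 0 h (i + (K + 1)) := by
            exact tsum_congr hg_tail
        _ = Fx * ∑' i, canaryA 0 h (i + (K + 1)) := tsum_mul_left
        _ ≤ Fx * canaryTaylorTail K J h := mul_le_mul_of_nonneg_left hTT hFx0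
        _ ≤ M * canaryTaylorTail K J h := mul_le_mul_of_nonneg_right hFsum hTT0
  -- `‖canaryF z − canaryF c‖ ≤ Σ g`
  have hdiff : ‖canaryF z - canaryF c‖ ≤ ∑' i, g i := hT1.norm_le_of_bounded hsg.hasSum hterm
  -- the centre value against the truncated series
  have hcen : (canaryS 0 N c / I ^ d).re - canaryTrunc 0 N x ≤ (canaryF c / I ^ d).re := by
    have h1 := re_div_I_pow_ge (canaryF c) (canaryS 0 N c) d
    have h2 : ‖canaryF c - canaryS 0 N c‖ ≤ canaryTrunc 0 N x := by
      rw [← canaryD_zero]; exact norm_canaryD_sub_canaryS_le hc (Nat.zero_le _) hq0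
    linarith
  have hzc := re_div_I_pow_ge (canaryF z) (canaryF c) d
  linarith

/-- **The analytic half of the contract (axis points).** `AxisIneq a d N xbar` implies
`0 < Re (canaryF t / I^d)` at `t = pieceCentre a 0 = a/2`. -/
theorem re_div_pos_of_axisIneq {a : ℤ} {d N xbar : ℕ} (hA : AxisIneq a d N xbar) :
    0 < (canaryF (pieceCentre a 0) / I ^ d).re := by
  obtain ⟨hN, ht, hq, hineq⟩ := hA
  have h1 := re_div_I_pow_ge (canaryF (pieceCentre a 0)) (canaryS 0 N (pieceCentre a 0)) d
  have h2 : ‖canaryF (pieceCentre a 0) - canaryS 0 N (pieceCentre a 0)‖ ≤ canaryTrunc 0 N xbar := by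
    rw [← canaryD_zero]; exact norm_canaryD_sub_canaryS_le ht (Nat.zero_le _) hq
  linarith

/-! ## 9. Real-axis readings (for the sign-alternation hypothesis of `CanaryAssembly`) -/

/-- Axis reading, `d = 0`: `AxisIneq a 0 N xbar → 0 < Re (canaryF (a/2))`. -/
theorem canaryF_re_pos_of_axisIneq {a : ℤ} {N xbar : ℕ} (hA : AxisIneq a 0 N xbar) :
    0 < (canaryF (((a : ℝ) / 2 : ℝ) : ℂ)).re := by
  have h := re_div_pos_of_axisIneq hA
  have hc : pieceCentre a 0 = (((a : ℝ) / 2 : ℝ) : ℂ) := by unfold pieceCentre; push_cast; ring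
  rwa [pow_zero, div_one, hc] at h

/-- Axis reading, `d = 2`: `AxisIneq a 2 N xbar → Re (canaryF (a/2)) < 0`. -/
theorem canaryF_re_neg_of_axisIneq {a : ℤ} {N xbar : ℕ} (hA : AxisIneq a 2 N xbar) :
    (canaryF (((a : ℝ) / 2 : ℝ) : ℂ)).re < 0 := by
  have h := re_div_pos_of_axisIneq hA
  have hc : pieceCentre a 0 = (((a : ℝ) / 2 : ℝ) : ℂ) := by unfold pieceCentre; push_cast; ring
  rw [hc, show (I : ℂ) ^ 2 = -1 from Complex.I_sq, div_neg, div_one, Complex.neg_re] at h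
  linarith

/-! ## 10. The two contract statements with explicit binders (the shapes `StepRuleContract` / `AxisContract`
of the assembly file are these, verbatim) -/

/-- **Step-rule contract, discharged**: for all piece rows, `PieceIneq ⇒ 0 < Re (canaryF z / I^d)` on the closed
disc of radius `L/2` about the centre. -/
theorem stepRule_of_pieceIneq :
    ∀ (a b : ℤ) (L d K N J xbar : ℕ), PieceIneq a b L d K N J xbar →
      ∀ z : ℂ, ‖z - pieceCentre a b‖ ≤ (L : ℝ) / 2 → 0 < (canaryF z / I ^ d).re :=
  fun _ _ _ _ _ _ _ _ hP z hz => re_div_pos_of_pieceIneq hP z hz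

/-- **Axis contract, discharged**: for all axis rows, `AxisIneq ⇒ 0 < Re (canaryF (a/2) / I^d)`. -/
theorem axisSign_of_axisIneq :
    ∀ (a : ℤ) (d N xbar : ℕ), AxisIneq a d N xbar → 0 < (canaryF (pieceCentre a 0) / I ^ d).re :=
  fun _ _ _ _ hA => re_div_pos_of_axisIneq hA

end Summit.RiemannHypothesis.RiemannHypothesis.Theorems.JensenPolynomials.LogBand.Canary

end
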